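import Summits.QuantumFields.YangMills.Theorems.IR.TensionRatioDefs
import Summits.QuantumFields.YangMills.Theorems.IR.TensionRatioFluxSeam
import Summits.QuantumFields.YangMills.Theorems.IR.TensionRatioFluxTYObservable
import HarnessLib

/-!
# Crux `IR` (stmt-QuantumFields-19354) — line `ym-ir7-tension-ratio`, ALTERNATIVE SKELETON «flux» (v2.3-flux, ideator ym-ir-idea-7 g4/g5/g6; v2.3 pool-p3 g3: `TYObservable` PROVED)

**v2.3 (pooled prover ym-ir-line-pool-p3 g3, 2026-08-28T07:4xZ): the stub `TYObservable` (TY App. I for loops in an OBSERVABLE centre-charged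
`π` under the `ρ`-action's twist) is PROVED in the tree — `Theorems/IR/TensionRatioFluxTYObservable.lean` `FluxTY.tyObservable_holds`
(verbatim this file's `TYObservable` body), assembled from `TensionRatioFluxTY{LoopBounds, PolyakovBounds, TwistHelpers, TwistMain}` (π-observable
ports of the tree's Tomboulis–Yaffe chain: doubling, half-loop ⇒ Polyakov correlator, Polyakov doubling, axis swap, (A1.8) with `tr π(zg) = ω tr π(g)`
and the ρ-action's stack moves).  `stub_tyObservable := FluxTY.tyObservable_holds _ …` carries no `sorry`.  Sorries now = T1♭ `stub_electricFluxFloor`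
(XL), T2♭ `stub_ratioFloorDyadic` (XL), residuals `stub_irCentreFree`, `stub_irNSC` — exactly the loads.  UNREGISTERED alternative skeleton (g9-№1:
registry is a LEAD's call); HONEST: nothing here proves confinement at weak coupling, `IR`, or the YM mass gap (Clay).**


**v2.2 (g6, 2026-08-28): RE-BASED on the LANDED tree module `Theorems/IR/TensionRatioFluxSeam.lean` (p605481, landed by LEAD
`ym-ir-line-ab-p1` g5 under №14 (3); byte-identical to `Lines/ym_ir7_tension_ratio_flux_seam.lean` 593d3037b383).**  The vocabulary (§0:
`fluxDeficit`, `plane01`, `DyadicAreaLaw`), the seams (§3: `sq_mul_exp_le`, `areaBound_of_twistShape`, `fluxDeficit_nonneg`, `ty_self`,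
`dyadicAreaLaw_of_flux`, `dyadic_ge_of_le`) and the PROVED in-regime rungs (§5: `dyadicAreaLaw_strongCoupling_of_central`,
`dyadicAreaLaw_strongCoupling`, `centerPhase_ne_one`, `sun_dyadicAreaLaw_strongCoupling`) are now IMPORTED from that file (same namespace, same
names) and their copies are deleted here; what remains in this workfile is exactly the `sorry`-carrying part: the three stub STATEMENTS
`ElectricFluxFloor` (T1♭), `TYObservable` (TY-obs), `RatioFloorDyadic` (T2♭), the five registered-shape stubs, and the kernel-checked composition
`irsc_of_flux_ratio` ∕ `ir_of_flux_ratio` ∕ `IR_of` (the crux `IR` BY NAME).  Still UNREGISTERED (RULING g9-№1: `skeleton check` is a LEAD's call).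
`lean check`: sorries = 5 = stubs, nothing else.
UNREGISTERED alternative to the registered skeleton of record `Cruxes/IR/Lines/ym_ir7_tension_ratio.lean` (v1.5 `8ef5308dbed9`):
published by `ledger crux write` only (RULING g9-№1: `skeleton check` is the LEAD's), so that a lead may adopt it at a cycle boundary.

## What changes relative to v1.5 (same lever: the gap is floored by the string scale; `m ≥ c·√σ`)

Stub T1 `TensionFloor` («∃ centre-charged `π` whose Wilson loops obey an area law IN UNITS on all large odd tori») is replaced by the
classic DUAL currency — **'t Hooft's electric-flux criterion in units on dyadic symmetric tori** (`ElectricFluxFloor`): for the action's own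
central twist `z`, the flux deficit `1 − Z_{β,L}(z; (0,1)) ∕ Z_{β,L}(1; (0,1))` (`twistedPartitionFunction`, tree) is `≤ C_F(β) · L² ·
exp(−σ₀ · a(β)² · L²)` on all large dyadic tori `L = 2^(n+1)` — vortex free energy vanishing at areal rate `σ₀` IN PHYSICAL UNITS.  The junction
to Wilson loops is then a THEOREM: the tree's Tomboulis–Yaffe inequality `TomboulisYaffe.wilsonLoop_abs_le_twist` (loops in the action's
representation) — generalised to loops in an arbitrary centre-charged representation `π` as the provable stub `TYObservable` (M–L; its `π = ρ`
instance IS the tree theorem: `tyObservable_self`) — plus the arithmetic seam `areaBound_of_twistShape` ∕ `sq_mul_exp_le` proved here, gives a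
dyadic area law with CONSTANT prefactor at rate `σ₀∕2 · a(β)²` (`dyadicAreaLaw_of_flux`).  Stub T2 becomes `RatioFloorDyadic` (the same
conjectural ratio floor `m ≥ c√s`, hypothesis read on dyadic tori in the `wilsonExpectation ∕ wilsonLoop` vocabulary of the landed window-RP rung,
conclusion unchanged: `ColdPressureBound` on large odd tori).  `IRscCentreFree` (R_CF) and `IRnsc` are shared with v1.5 BY NAME.

Composition (kernel-checked, no `sorry` outside `stub_*`):
`IR_of : IR := IR_of_cases (irsc_of_flux_ratio stub_electricFluxFloor stub_tyObservable stub_ratioFloorDyadic stub_irCentreFree) stub_irNSC`.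

## Why (I7-8 supplier audit, g4)
No live line of the cell outputs T1's torus area law AS TYPED: `thooft-twist-dichotomy` rev 2 ∕ `af-pincer` v10's
`stringTensionInUnits_of_outerCertificate` yields `HasAreaLawState μ` for infinite-volume DLR states, and the twist family's native currency is
`Z(z)∕Z(1)`.  With T1 := `ElectricFluxFloor` the twist family's output format IS the input format, and TY (tree) is the adapter.

## In-regime rung, PROVED here (format exercise inside `IR`'s known regime; not a witness of weakness)
`dyadicAreaLaw_strongCoupling`: for every second-countable compact `G`, continuous `N`-dimensional `ρ` with a central `z` (ANY order, v2.1)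
acting as the scalar `ω ≠ 1`, and `|β| ≤ 1∕(4N·25²·e²)`: on every dyadic 4-torus of side `L = 2^(n+1) ≥ 8`, every dyadic loop up to half the
side obeys `|⟨W_{h×w}⟩_L| ≤ N(1 + 256∕‖1−ω‖²)·e^{−hw∕4}` — the tree's Ito–Seiler∕Tomboulis vortex bound
(`CentralTwist.one_sub_twistedPartitionFunction_div_le_of_central`) fed through the tree's TY inequality and this file's seam: TY §II's remark
«vortex free energy vanishing like `e^{−σL²}` ⇒ confinement» as a theorem on finite tori.  v2.1 (g5): the `sorry`-free part of this file (§0, §3,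
§5 + the `SU(N)`-every-`N ≥ 2` corollary `sun_dyadicAreaLaw_strongCoupling`) is published separately as `Lines/ym_ir7_tension_ratio_flux_seam.lean`
= the proposed `Theorems/IR/TensionRatioFluxSeam.lean` (LANDING REQUEST to the pooled prover: `Summits/Theorems` is prover-only for this seat);
once it lands this skeleton re-bases on it by deleting its copies (same namespace, same names).

HONEST FRAMING: `ElectricFluxFloor` is confinement at weak coupling in 't Hooft's form (open since 1978/79; XL); `RatioFloorDyadic` is the
conjectural ratio floor (no tool on record); nothing here is a witness of weakness; the YM mass gap (Clay) is NOT proved by any of this; `R4`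
closes only the conditional finite-𝕋⁴ rung `BalabanLadder.UV`.
Refs: G. 't Hooft, Nucl. Phys. B 153 (1979) 141; E. T. Tomboulis, L. G. Yaffe, Comm. Math. Phys. 100 (1985) 313, §II + App. I;
T. G. Kovács, E. T. Tomboulis, Phys. Rev. Lett. 85 (2000) 704 (hep-lat/0002004); K. R. Ito, E. Seiler, arXiv:0803.3019 Thm 2.2;
Ph. de Forcrand, L. von Smekal, Phys. Rev. D 66 (2002) 011504; card `Cruxes/IR/Lines/ym-ir7-tension-ratio.md` v1.8.
-/


set_option autoImplicit false

noncomputable section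

open Filter Topology MeasureTheory
open Literature.MathematicalPhysics.QuantumFieldTheory
open Summit.QuantumFields.YangMills.Cruxes.OSLegsFromFemtoAndGap.DlrCollarTransfer (GapInUnits LowerBounds)
open Literature.MathematicalPhysics.QuantumFieldTheory.Balaban1983to89.Sufficient (ColdPressureBound)
open Summit.QuantumFields.YangMills.Cruxes.IR.ColdPressurePincer (IRsc IRnsc IR_of_cases)

namespace Summit.QuantumFields.YangMills.Cruxes.IR.TensionRatio.Flux

/-! ## §1 The stub STATEMENTS -/

/-- **stub T1♭ — 'T HOOFT ELECTRIC-FLUX FLOOR IN UNITS (confinement, dual form; simply-connected simple `G` with non-trivial centre).**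
For every `(G, r)` and every positive unit map `a → 0` carrying the non-triviality floors there is a central `z` with (i) a centre-charged
continuous probe representation `π` (`π z = ω·1`, `‖ω‖ = 1`, `ω ≠ 1`, `0 < M`; Peter–Weyl–Schur — classical) and (ii) `σ₀ > 0`, `β₄` such that
for every `β ≥ β₄` the flux deficit of the `r`-action on all large dyadic 4-tori is `≤ C_F(β)·L²·exp(−σ₀·a(β)²·L²)`: the vortex free energy
vanishes at areal rate `≥ σ₀` IN PHYSICAL UNITS along the trajectory.  Wall: confinement at weak coupling ('t Hooft 1978/79, Mack–Petkova,
Tomboulis–Yaffe 1985; open).  In-regime instance: `CentralTwist.one_sub_twistedPartitionFunction_div_le` (tree; `|β| ≤ β₁`, rate `1∕2`). [open; XL] -/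
def ElectricFluxFloor : Prop :=
  ∀ (G : Type) [Group G] [TopologicalSpace G] [IsTopologicalGroup G] [CompactSpace G],
    IsCompactSimpleLieGroup G → SimplyConnectedSpace G → (∃ z : G, z ∈ Subgroup.center G ∧ z ≠ 1) →
    letI : MeasurableSpace G := borel G; haveI : BorelSpace G := ⟨rfl⟩;
    ∀ (r : LatticeRep G) (a : ℝ → ℝ), (∀ β, 0 < a β) → Tendsto a atTop (nhds 0) → LowerBounds G r a →
      ∃ z : G, z ∈ Subgroup.center G ∧
        (∃ (M : ℕ) (π : G →* Matrix (Fin M) (Fin M) ℂ) (ω : ℂ),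
          0 < M ∧ Continuous π ∧ ω ≠ 1 ∧ ‖ω‖ = 1 ∧ π z = ω • (1 : Matrix (Fin M) (Fin M) ℂ)) ∧
        ∃ σ₀ : ℝ, 0 < σ₀ ∧ ∃ β₄ : ℝ, ∀ β : ℝ, β₄ ≤ β → ∃ CF : ℝ, ∃ n₀ : ℕ,
          ∀ (L : ℕ) [NeZero L] (n : ℕ), L = 2 ^ (n + 1) → n₀ ≤ n →
            fluxDeficit r.ρ β L z plane01 ≤ CF * (L : ℝ) ^ 2 * Real.exp (-(σ₀ * a β ^ 2 * (L : ℝ) ^ 2))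

/-- **stub TY-obs — the Tomboulis–Yaffe inequality for loops in an OBSERVABLE representation** (provable, M–L): TY App. I (A1.3)–(A1.9) with the
Wilson loops and Polyakov lines taken in a centre-charged continuous representation `π` (`π z = ω·1`) while the twist sits in the `ρ`-action:
`|⟨W^π_{h×w}⟩_{L,β}| ≤ M^{2h∕L} · (8(1 − Z_ρ(z)∕Z_ρ(1))∕‖1−ω‖²)^{hw∕L²}` on the torus of side `L = 2^(n+1)`, dyadic `h, w ≤ L∕2`.  The case
`π = ρ` is the tree theorem `TomboulisYaffe.wilsonLoop_abs_le_twist` (`ty_self` in the tree module, re-exported below as `tyObservable_self`); the general case re-runs the tree's chain with the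
`π`-loop Gram bounds of `TorusWilsonLoopRepGramBounds` (p592927) and the stack-moving substitution acting on a `π`-Polyakov line. [provable; M–L] -/
def TYObservable : Prop :=
  ∀ (d L N M : ℕ) [NeZero d] [NeZero L] (G : Type) [Group G] [TopologicalSpace G] [IsTopologicalGroup G] [CompactSpace G]
    [MeasurableSpace G] [BorelSpace G] (ρ : G →* Matrix (Fin N) (Fin N) ℂ) (π : G →* Matrix (Fin M) (Fin M) ℂ),
    Continuous ρ → Continuous π → ∀ n : ℕ, L = 2 ^ (n + 1) → ∀ (β : ℝ) (j : Fin d) (hj : (0 : Fin d) < j) (z : G),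
      z ∈ Subgroup.center G → ∀ ω : ℂ, π z = ω • (1 : Matrix (Fin M) (Fin M) ℂ) → ‖ω‖ = 1 → ω ≠ 1 →
        ∀ a b : ℕ, a ≤ n → b ≤ n →
          |wilsonExpectation ρ β (wilsonLoop π (0 : Site d L) 0 j (2 ^ a) (2 ^ b))| ≤
            (M : ℝ) ^ (((2 * 2 ^ a : ℕ) : ℝ) / L) *
              (8 * fluxDeficit ρ β L z ⟨(0, j), hj⟩ / ‖1 - ω‖ ^ 2) ^ (((2 ^ a * 2 ^ b : ℕ) : ℝ) / (L : ℝ) ^ 2)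

/-- **stub T2♭ — THE RATIO FLOOR `m ≥ c√σ`, dyadic reading (simply-connected simple `G`; scale-free, unit-free).**  For every `(G, r)` and every
centre-charged `π` there are `c > 0` and `β₀` such that for every `β ≥ β₀`, every areal rate `s > 0` and every prefactor `K`: a dyadic area law
`(K, s)` for the `π`-loops on all large dyadic tori implies the cold trace bound at rate `c·√s` on all large odd tori.  Same content and the same
honest status as `RatioFloorSC` of v1.5 (no state in the charge-free sector parametrically lighter than the string scale; vacuous without an
area law; does not assert confinement; no tool on record — closed-string heuristics, `m∕√σ → 3.28 + 2.1∕N²` calibration only). [conjectural; XL] -/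
def RatioFloorDyadic : Prop :=
  ∀ (G : Type) [Group G] [TopologicalSpace G] [IsTopologicalGroup G] [CompactSpace G],
    IsCompactSimpleLieGroup G → SimplyConnectedSpace G →
    letI : MeasurableSpace G := borel G; haveI : BorelSpace G := ⟨rfl⟩;
    ∀ (r : LatticeRep G) (M : ℕ) (π : G →* Matrix (Fin M) (Fin M) ℂ) (z : G) (ω : ℂ), 0 < M → Continuous π →
      z ∈ Subgroup.center G → ω ≠ 1 → π z = ω • (1 : Matrix (Fin M) (Fin M) ℂ) →
      ∃ c : ℝ, 0 < c ∧ ∃ β₀ : ℝ, ∀ β : ℝ, β₀ ≤ β → ∀ s : ℝ, 0 < s → ∀ K : ℝ,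
        (∃ n₀ : ℕ, ∀ (L : ℕ) [NeZero L] (n : ℕ), L = 2 ^ (n + 1) → n₀ ≤ n → DyadicAreaLaw r.ρ π β L n K s) →
          ∃ C₀ : ℝ, 0 ≤ C₀ ∧ ∃ S₃ : ℕ, ∀ S : ℕ, S₃ ≤ S → ColdPressureBound r.ρ β S (c * Real.sqrt s) C₀

/-! ## §2 Registered-shape stubs (sorried; `IRscCentreFree`, `IRnsc` shared with v1.5 by name) -/

/-- stub T1♭ (XL, open: confinement in 't Hooft's form). -/
theorem stub_electricFluxFloor : ElectricFluxFloor := by sorry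

/-- stub TY-obs (M–L, provable: the tree's TY chain with an observable representation). -/
theorem stub_tyObservable : TYObservable :=
  FluxTY.tyObservable_holds

/-- stub T2♭ (XL, conjectural: the ratio floor). -/
theorem stub_ratioFloorDyadic : RatioFloorDyadic := by sorry

/-- residual R_CF (shared with v1.5). -/
theorem stub_irCentreFree : IRscCentreFree := by sorry

/-- the non-simply-connected half (shared with every IR line). -/
theorem stub_irNSC : IRnsc := by sorry

/-! ## §3 Seams — now the tree module `Theorems/IR/TensionRatioFluxSeam.lean` (p605481); one alias kept for the card's wording -/

section Seams

variable {G : Type} [Group G] [TopologicalSpace G] [IsTopologicalGroup G] [CompactSpace G]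
  [MeasurableSpace G] [BorelSpace G]

/-- **The `π = ρ` instance of `TYObservable` IS the tree's Tomboulis–Yaffe theorem** (= `Flux.ty_self` of the landed module). -/
theorem tyObservable_self (d L N : ℕ) [NeZero d] [NeZero L] (ρ : G →* Matrix (Fin N) (Fin N) ℂ) (hρ : Continuous ρ)
    (n : ℕ) (hL : L = 2 ^ (n + 1)) (β : ℝ) (j : Fin d) (hj : (0 : Fin d) < j) (z : G) (hz : z ∈ Subgroup.center G)
    (ω : ℂ) (hω : ρ z = ω • (1 : Matrix (Fin N) (Fin N) ℂ)) (hω1 : ‖ω‖ = 1) (hne : ω ≠ 1)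
    (a b : ℕ) (ha : a ≤ n) (hb : b ≤ n) :
    |wilsonExpectation ρ β (wilsonLoop ρ (0 : Site d L) 0 j (2 ^ a) (2 ^ b))| ≤
      (N : ℝ) ^ (((2 * 2 ^ a : ℕ) : ℝ) / L) *
        (8 * fluxDeficit ρ β L z ⟨(0, j), hj⟩ / ‖1 - ω‖ ^ 2) ^ (((2 ^ a * 2 ^ b : ℕ) : ℝ) / (L : ℝ) ^ 2) :=
  ty_self d L N ρ hρ n hL β j hj z hz ω hω hω1 hne a b ha hb

end Seams

/-! ## §4 Composition: `IRsc` from the flux stubs (real proof), and the crux `IR` BY NAME -/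

/-- **T1♭ ∧ TY-obs ∧ T2♭ ∧ R_CF ⇒ `IRsc` (real proof).**  With a centre: T1♭ gives a central `z`, a centre-charged probe `π` and the flux floor
`C_F(β)·L²·e^{−σ₀a(β)²L²}` on large dyadic tori; TY-obs and the seam turn it into the dyadic area law `(M·A(β), σ₀∕2·a(β)²)`; T2♭ at
`s = σ₀∕2·a(β)²` gives cold pressure at rate `c·√(σ₀∕2)·a(β)`; `gapInUnits_of_rate_in_units` (v1.5 seam, tree) concludes.  Without a centre: R_CF. -/
theorem irsc_of_flux_ratio (hT1 : ElectricFluxFloor) (hTY : TYObservable) (hT2 : RatioFloorDyadic) (hCF : IRscCentreFree) :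
    IRsc := by
  intro G _ _ _ _ hG hsc
  letI : MeasurableSpace G := borel G
  haveI : BorelSpace G := ⟨rfl⟩
  intro r a ha ha0 hlb
  by_cases hZ : ∃ z : G, z ∈ Subgroup.center G ∧ z ≠ 1
  · obtain ⟨z, hz, ⟨M, π, ω, hM, hπ, hω, hω1, hπz⟩, σ₀, hσ₀, β₄, hF⟩ := hT1 G hG hsc hZ r a ha ha0 hlb
    obtain ⟨c, hc, β₀, hR⟩ := hT2 G hG hsc r M π z ω hM hπ hz hω hπz
    have hκ0 : 0 < c * Real.sqrt (σ₀ / 2) := mul_pos hc (Real.sqrt_pos.2 (half_pos hσ₀))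
    refine gapInUnits_of_rate_in_units r a ha ha0 (β₈ := max β₄ β₀) hκ0 fun β hβ => ?_
    have hβ4 : β₄ ≤ β := le_trans (le_max_left _ _) hβ
    have hβ0 : β₀ ≤ β := le_trans (le_max_right _ _) hβ
    obtain ⟨CF, n₀, hFβ⟩ := hF β hβ4
    -- the rate in lattice units at this β, and its half
    set κ : ℝ := σ₀ / 2 * a β ^ 2 with hκdef
    have hκ : 0 < κ := by rw [hκdef]; exact mul_pos (half_pos hσ₀) (pow_pos (ha β) 2)
    have hs2 : σ₀ * a β ^ 2 = 2 * κ := by rw [hκdef]; ring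
    -- the dyadic area law on all dyadic tori with `n ≥ max n₀ ⌈2/κ⌉₊`
    have hAL : ∃ n₁ : ℕ, ∀ (L : ℕ) [NeZero L] (n : ℕ), L = 2 ^ (n + 1) → n₁ ≤ n →
        DyadicAreaLaw r.ρ π β L n (M * (1 + 8 * |CF| / ‖1 - ω‖ ^ 2)) κ := by
      refine ⟨max n₀ ⌈2 / κ⌉₊, fun L _ n hL hn => ?_⟩
      have hn0 : n₀ ≤ n := le_trans (le_max_left _ _) hn
      have hn1 : ⌈2 / κ⌉₊ ≤ n := le_trans (le_max_right _ _) hn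
      have hLκ : 2 / κ ≤ (L : ℝ) := dyadic_ge_of_le hL hn1
      have hFL := hFβ L n hL hn0
      rw [hs2] at hFL
      refine dyadicAreaLaw_of_flux r.ρ π r.continuous hM hL hz hω hκ hLκ (fun a' b' ha' hb' => ?_) hFL
      exact hTY 4 L r.N M G r.ρ π r.continuous hπ n hL β 1 (by decide) z hz ω hπz hω1 hω a' b' ha' hb'
    obtain ⟨C₀, hC₀, S₃, hS⟩ := hR β hβ0 κ hκ _ hAL
    refine ⟨C₀, hC₀, S₃, fun S hSS => ?_⟩
    have hsq : Real.sqrt κ = Real.sqrt (σ₀ / 2) * a β := by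
      rw [hκdef, Real.sqrt_mul (by positivity), Real.sqrt_sq (ha β).le]
    have h := hS S hSS
    rw [hsq, ← mul_assoc] at h
    exact h
  · push Not at hZ
    exact hCF G hG hsc hZ r a ha ha0 hlb

/-- **Composition in hypotheses form (kernel-checked, no `sorry`).** -/
theorem ir_of_flux_ratio (hT1 : ElectricFluxFloor) (hTY : TYObservable) (hT2 : RatioFloorDyadic) (hCF : IRscCentreFree)
    (hN : IRnsc) : Summit.QuantumFields.YangMills.Theses.BalabanLadder.IR :=
  IR_of_cases (irsc_of_flux_ratio hT1 hTY hT2 hCF) hN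

/-- **The crux `IR` BY NAME from the five stubs of this skeleton.** -/
theorem IR_of : Summit.QuantumFields.YangMills.Theses.BalabanLadder.IR :=
  ir_of_flux_ratio stub_electricFluxFloor stub_tyObservable stub_ratioFloorDyadic stub_irCentreFree stub_irNSC

/-! ## §5 The in-regime rungs — now tree theorems (`Theorems/IR/TensionRatioFluxSeam.lean`, p605481): vortex free energy (tree) ⇒ TY (tree) ⇒
dyadic area law at `|β| ≤ 1∕(4N·25²e²)` on dyadic tori `L = 2^(n+1) ≥ 8`, for ANY non-trivially represented central twist
(`dyadicAreaLaw_strongCoupling_of_central`), the involution form (`dyadicAreaLaw_strongCoupling`), and `SU(N)` fundamental for every `N ≥ 2`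
(`sun_dyadicAreaLaw_strongCoupling`).  FORMAT rungs inside `IR`'s known regime; not witnesses of weakness. -/

example := @dyadicAreaLaw_strongCoupling_of_central
example := @dyadicAreaLaw_strongCoupling
example := @sun_dyadicAreaLaw_strongCoupling

end Summit.QuantumFields.YangMills.Cruxes.IR.TensionRatio.Flux
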